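import Mathlib
import HarnessLib
import HarnessLib.Audit
import Summits.AtomisticToContinuum.Statement
import Literature.MathematicalPhysics.QuantumManyBody.PeriodicBoseGas

/-!
Route: BECBathMassDial

CLOSED (retired) 2026-08-15T13:38:29Z by operator:999:1257524 — reason: not-a-thesis: assembly does not conclude the sub-problem Statement — note: D-0027 §2.1 audit (human 2026-08-15: routes that do not decide the summit are removed): the assembly concludes `Literature.MathematicalPhysics.QuantumManyBody.BoseGas.BoseEinsteinCondensation`, not the sub-problem statement; a NEW conforming route may be opened from the same idea (generated `closes . The file is kept as the record of this route; refuted decls are indexed as negative knowledge (`ledger negatives`).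

# Route BECBathMassDial — bath-mass dial — torus BEC as space-time delocalisation of a tagged boson
from a uniform density-response bound, with frozen (no BEC) and light-bath (coherent) endpoints

It suffices to show X = DensityResponseBound ∧ SpaceTimeHomogenisation on the torus of side L =
(N/ρ)^{1/3} (card
frozen-bath-anderson-endpoint, its η = 1 engine made explicit): (D) a uniform static
density-response (compressibility-type)
bound for the periodic ground state of every repulsive finite-range v with positive scattering
length — the cosine-sourced
ground-state energy responds at most quadratically, E₀^per + tN ≤ E₀^per[t(1+cos k·x)] + Ct²N for k
in the dual lattice,
t small, C = C(ρ,v) uniform in N and k (equivalently m₋₁(ρ_k) ≤ CN: finite compressibility at all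
wavelengths, the H₋₁ /
time-averaging input); (E) the space-time homogenisation step — (D) for v implies constant-mode
condensation of periodic
near-minimisers, i.e. the body of PeriodicBEC (stmt-0826) for that v. Together with the free case
(scattering length 0,
support FreeGasCondenses) this gives PeriodicBEC, and the shared transfer BoundaryTransferWeak
(stmt-0827) gives the
Dirichlet, mode-free conjunct. The card's dial (bath kinetic weight η⁻¹) is filed at both ends:
LightBathCoherence (η → 0:
the tagged boson is completely coherent, a perturbative corner of (E)) and FrozenBathNoBEC (η = ∞,
quenched: Lifshitz
localisation, no condensation — the calibration that any valid mechanism must spend the bath's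
kinetic energy).
Lean: `DensityResponseBound ∧ SpaceTimeHomogenisation` — decls of this route, one-line Props over
Literature.MathematicalPhysics.QuantumManyBody.BoseGas.{IsRepulsiveFiniteRange, scatteringLength,
PeriodicTrialState, periodicEnergy, periodicGroundStateEnergy, periodicInteraction,
periodizedPotential, kineticDensity, cellN, Config, Space, sideLength, condensateOccupation,
HasGroundStateBEC, BoseEinsteinCondensation}, written out under Cruxes (rc 0 in Sketch.lean,
assembly term `assembly_holds` sorry-free)

## Assembly
Pure logic, sorry-free in Sketch.lean (theorem assembly_holds, axioms propext/choice/Quot.sound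
only): fix v admissible;
`eq_zero_or_pos (scatteringLength v)`; if a = 0, FreeGasCondenses gives the PeriodicBEC body for v;
if a > 0,
DensityResponseBound gives the response body and SpaceTimeHomogenisation turns it into the
PeriodicBEC body; in both cases
BoundaryTransferWeak returns ∃ρ₀ ∀ρ∈(0,ρ₀) HasGroundStateBEC v ρ, which is the conjunct
Literature.MathematicalPhysics.QuantumManyBody.BoseGas.BoseEinsteinCondensation (= the audited
abbrev BoseEinsteinCondensation).
The target PeriodicBEC (stmt-0826) drops out on the way (theorem periodicBEC_of_cruxes).
LightBathCoherence and
FrozenBathNoBEC are the two ends of the dial: they calibrate SpaceTimeHomogenisation (its constants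
must interpolate
between 'coherent' and 'localised') and are not hypotheses of the assembly.

Rationale: WHY THIS LINE. Read n₀/N on the torus as the L²-flatness, in the tagged coordinate, of the insertion
amplitude h = Ψ_{N+1}/Ψ_N, a positive
solution of a linear parabolic-type equation (−G_N − Δ_y + Σ_j v(y − x_j))h = μ_N h driven by the
space-time random medium
that the recoiling bath generates (G_N = ground-state-transformed generator): T = 0 BEC is many-body
ANTI-localisation, and
the card's dynamic Harris count g²(ℓ) ≍ (a²ρ/c²)ℓ^{2−d} says the medium is irrelevant in d = 3
exactly because time-averaging
over ℓ² gains a factor governed by the static response m₋₁ (Stringari1995 §2.2 p.74: ∫ω⁻¹S = ½χ(q) →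
1/mc², divergent as
1/q² for the ideal gas — hence the hypothesis a > 0). Imported areas, with dictionary: quantitative
stochastic homogenisation
/ large-scale regularity for parabolic equations (ArmstrongBordasMourrat2018,
ArmstrongKuusiMourrat2019) and its
configuration-space version for interacting particle systems (GiuntiGuMourrat2022) [environment ↦
|Ψ_N|²-stationary bath
dynamics; corrector ↦ log h − const; ellipticity defect at scale ℓ ↦ g(ℓ); H₋₁ norm of the drift ↦
m₋₁ bound (D),
KipnisVaradhan1986]; random Schrödinger / Lifshitz-tail localisation for the frozen endpoint
(Sznitman1998,
GerminetHislopKlein2007); Bose-polaron physics for the light-bath endpoint (MysliwySeiringer2020,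
LampartTriay2025,
GuentherEtAl2021, CucchiettiTimmermans2006 for the self-trapping threshold η_c ≍ ρ^{-1/2} that
bounds the dial). What it
does that open routes do not: BECImpurityMassFlow deforms the PROBE mass and needs a
static-scatterer fidelity (its own
why-might-fail asks for a Landau gap); BECParticleInduction consumes a Dirichlet m₋₁ bound inside a
particle-number
induction; here the bath-mass dial isolates the weakest spectral input (finite compressibility, not
a linear gap) and a
homogenisation engine on the translation-invariant torus, and files a provable negative endpoint;
negatives index empty.

RANKED CRUXES. #0 PeriodicBEC (target) — the shared torus target = route BECPeriodicReduction's crux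
PeriodicBEC (stmt-0826), verbatim: for every repulsive finite-range v there is ρ₀>0 such that for
0<ρ<ρ₀ there is c>0 with: for all large N there is δ>0 such that every periodic trial state on the
torus of side (N/ρ)^{1/3} with periodicEnergy ≤ E₀^per+δ has condensateOccupation ≥ cN. In THIS
route it follows from DensityResponseBound, SpaceTimeHomogenisation and FreeGasCondenses by a
dichotomy on the scattering length (theorem periodicBEC_of_cruxes in Sketch.lean). (why it might
fail: Box L=(N/ρ)^{1/3}→∞ at fixed ρ: every printed n₊ bound pays the box gap L² (Fournais2020 Thm
1.2, Junge2026 Cor. 6); T=0 d=3 expansions are IR-singular; hard cores admissible, c uniform in N —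
the open problem in its own setting.) [LiebSeiringerSolovejYngvason2005, Fournais2020, Junge2026,
ChongLiangNam2026, Literature.Barriers.AtomisticToContinuum.KineticGapLengthScales]
#2 DensityResponseBound (crux) — (card L1's mixing input, made explicit and typed) UNIFORM STATIC
DENSITY RESPONSE ON THE TORUS: for every repulsive finite-range v with scatteringLength v > 0 there
is ρ₀>0 such that for 0<ρ<ρ₀ there is C>0 with: for all large N (L=(N/ρ)^{1/3}), every dual-lattice
vector k = 2πn/L, n ∈ ℤ³∖{0}, admits t₀>0 such that for 0<t≤t₀: E₀^per(N,L) + tN ≤ inf_Ψ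
[periodicEnergy v Ψ + ∫ Σ_j t(1+cos k·x_j)|Ψ|²] + C t² N. Since ⟨cos k·x⟩ = 0 in the
translation-invariant ground state the first order is exactly tN, so this is m₋₁(Σ_j cos k·x_j) ≤
CN, i.e. χ(k)/N bounded uniformly in N and k ≠ 0 (finite compressibility at every wavelength:
Bogoliubov value m₋₁/N = ½/(k²+16πρa) ≤ 1/(32πρa), so C ≍ 1/(ρa)); t₀ innermost makes it purely
infinitesimal. It is the H₋₁-norm bound the time-averaging step of the engine consumes (variance of
a potential averaged over imaginary time T is ≤ (2/T)·m₋₁). The ideal gas violates it (m₋₁/N =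
1/(2k²) → ∞ at k = 2π/L; Stringari1995 p.74), hence a > 0. Torus/thermodynamic-sequence sibling of
BECParticleInduction.StaticResponseBound (stmt-3590: Dirichlet, all M ≤ ρ₁L³, Bogoliubov weight) — a
proof of either should give the other's geometry. [difficulty: open-problem] (why it might fail: It
is m₋₁ of the TRUE torus ground state uniform in N at k_min=2π/L→0, i.e. a one-sided bound H−E₀ ≳
S(k)/C on ρ_kΨ₀ (no soft density mode): printed spectra stop at mean-field/GP boxes (Seiringer2011,
BoccatoEtAl2019Acta); energy localisation carries t-independent errors and never reaches t→0.)
[Stringari1995, PitaevskiiStringari1991, Seiringer2011, BoccatoEtAl2019Acta, FournaisSolovej2020,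
KipnisVaradhan1986, Literature.Barriers.AtomisticToContinuum.KineticGapLengthScales]
#3 SpaceTimeHomogenisation (crux) — (card L1 = SpaceTimeLiouville, as an implication between typed
statements) THE ENGINE: for every repulsive finite-range v with scatteringLength v > 0, the
density-response body of DensityResponseBound for v implies the PeriodicBEC body for v (∃ρ₀ ∀ρ<ρ₀ ∃c
∀ᶠN ∃δ: δ-near-minimisers of the periodic energy on the torus of side (N/ρ)^{1/3} have
condensateOccupation ≥ cN). Intended proof object: the insertion amplitude h(y;X) =
Ψ_{N+1}(y,X)/Ψ_N(X) > 0 solves (−G_N − Δ_y + Σ_j v^per(y − x_j))h = (E_{N+1} − E_N)h with G_N the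
ground-state-transformed generator of the N-boson bath; n₀(N+1)/(N+1) ≥ ⟨φ₀⊗Ψ_N, Ψ_{N+1}⟩² = (E_π
h)²/E_π h² (Cauchy–Schwarz), so a first-order Liouville / large-scale-regularity theorem 'positive
sub-quadratically growing solutions are constant up to a corrector bounded in L²(π)' in the
|Ψ_N|²-stationary space-time environment IS torus BEC. Scale-ℓ ellipticity defect g²(ℓ) = Var(block
potential averaged over time ℓ²)·ℓ⁴ ≤ (2/ℓ²)·m₋₁(block density)·v̂(0)²·ℓ⁴ ≍ (a²ρ·C)ℓ^{-1} in d = 3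
by the hypothesis: irrelevant, already ≍ √(ρa³) at ℓ = healing length; d = 2 marginal, d = 1
relevant (no BEC, consistent with PitaevskiiStringariOneDimension). Technology to transplant:
ArmstrongBordasMourrat2018 (parabolic, finite-range space-time dependence), GiuntiGuMourrat2022
(homogenisation on the configuration space of an interacting particle system — the environment IS
the particles, as here), KipnisVaradhan1986 (H₋₁ ⇒ corrector). [deps: DensityResponseBound]
[difficulty: open-problem] (why it might fail: ABM/GGM regularity needs quantitative decorrelation
of ALL coarse-grained functionals of an environment with known product/Poisson law, independent of
the walker; here the law |Ψ_N|² is unknown, the walker is one of the bosons (self-consistent), and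
m₋₁ bounds only second moments of time averages.) [ArmstrongBordasMourrat2018, GiuntiGuMourrat2022,
ArmstrongKuusiMourrat2019, KipnisVaradhan1986, DrewitzEtAl2011, Sznitman1998,
Literature.Barriers.AtomisticToContinuum.BogoliubovPerturbationInfrared]
#4 LightBathCoherence (crux) — (card L3, the η → 0 end of the bath-mass dial, typed as complete
coherence) LIGHT, FAST BATH: for every repulsive finite-range v with ∫v(|x|)dx < ∞, every ρ > 0 and
ε > 0 there is η₀ > 0 such that for 0 < η < η₀ and all large N there is δ > 0 with: every C¹,
Lℤ³-periodic (in each of the N+1 particles), cell-normalised ψ on (ℝ³)^{N+1} — NO permutation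
symmetry imposed, particle 0 tagged — whose deformed energy E_η(ψ) = ∫_cell |∇₀ψ|² +
η⁻¹Σ_{j≥1}|∇_jψ|² + Σ_{i<j} v^per(x_i − x_j)|ψ|² is within δ of its infimum has tagged constant-mode
weight ≥ 1 − ε, i.e. condensateOccupation (N+1) L ψ ≥ (1−ε)(N+1) (L = ((N+1)/ρ)^{1/3}; the head of
vecCons is particle 0, so condensateOccupation/(N+1) is exactly the tagged zero-mode weight; at η =
1 the absolute ground state is the Bose-symmetric one and this weight IS n₀/N). Multiplying by η: a
heavy probe (mass ∝ 1/η) coupled by ηv to a bath with pair coupling ηv; one loop gives 1 − Z ≍ ρ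
a_η² ξ_η ≍ η^{3/2}ρ^{1/2}(∫v)^{3/2} → 0 (a_η ≍ η∫v/8π, ξ_η the bath healing length), the
perturbative corner of SpaceTimeHomogenisation with no self-consistency (the probe barely perturbs
the bath) — but only because the weakly coupled bath still has phonons. [difficulty: XL] (why it
might fail: Z→1 needs the phonon branch of the WEAKLY coupled bath (S(k)≲k/2c_η, c_η∝√(ηρ∫v))
uniformly in N — unproved in the TL at any coupling; with S≡1 (ideal bath) a heavy probe has a
bosonic orthogonality catastrophe (GuentherEtAl2021 eq. 3), so constants must degenerate exactly
right as η→0.) [MysliwySeiringer2020, LampartTriay2025, GuentherEtAl2021,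
AstrakharchikPitaevskii2004, CucchiettiTimmermans2006, Seiringer2011]
#5 BoundaryTransferWeak (crux) — shared with BECPeriodicReduction (stmt-0827), verbatim: for each
repulsive finite-range v, the PeriodicBEC body for v implies ∃ρ₀>0 ∀ρ∈(0,ρ₀) HasGroundStateBEC v ρ
(Dirichlet ground state, λ_max(γ) ≥ cN via condensateNumber). Not glue: near-minimiser slacks are
O(N/L²) while Dirichlet/periodic energies differ by a boundary term ≫ N/L²; expected route: Neumann
bracketing of interior sub-boxes + a mode-free criterion (λ_max ≥ tr γ²/N). v ≡ 0: both sides true.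
[difficulty: L] (why it might fail: PeriodicBEC(v) is ground-state-only (δ after N) at the box
(N/ρ)^{1/3}: the Dirichlet ground state is a periodic trial state but lies a wall term ≫δ above
E₀^per and interior restrictions are neither periodic nor of sharp N, so the hypothesis may never
fire; BEC is BC-sensitive (Robinson1976).) [LiebSeiringerSolovejYngvason2005, Basti2022,
BoccatoSeiringer2023, Junge2026, Robinson1976, LauwersVerbeureZagrebnov2003]
#9 FrozenBathNoBEC (support) — (card L2 = Q-loc, the η = ∞ endpoint, quenched i.i.d. version;
provable now) FROZEN BATH NEVER CONDENSES: for every repulsive finite-range v with scatteringLength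
v > 0, every density ρ > 0 and ε > 0, for all large M (L = (M/ρ)^{1/3}): the set of scatterer
configurations Y ∈ cell^M for which the ONE-body quenched problem h_Y = −Δ + Σ_j v^per(x − Y_j) on
the torus has near-ground states (energy ≤ e_Y + δ for every δ > 0) with constant-mode weight > ε
has Lebesgue measure ≤ ε·|cell^M| (i.e. probability ≤ ε under i.i.d. uniform scatterers at density
ρ). Elementary proof (no Sznitman machinery needed): (i) whp there is an empty ball of radius R+R₀,
so e_Y ≤ π²/R² → 0; (ii) chop the torus into cubes of side ℓ, drop the kinetic cross terms (Neumann
bracketing, v ≥ 0): a cube whose inner half-cube holds a scatterer has local Neumann ground energy ≥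
c(ℓ,v) > 0 uniformly in the position (compactness), so a near-ground state puts mass ≤ (e_Y+δ)/c(ℓ)
→ 0 in occupied cubes; (iii) the fraction of unoccupied cubes concentrates at e^{−ρℓ³/8}; (iv)
Cauchy–Schwarz: (∫φ)²/L³ ≤ 2·mass_occ + 2·(unoccupied volume fraction) → 0 as ℓ → ∞. Same argument
for hard cores. This is the card's calibration: a mechanism whose estimates are insensitive to the
bath's kinetic term proves nothing, since freezing the bath kills condensation at every density and
dimension; the physical large-η phase of the true dial is self-trapping (bubble, η_c ≍
(a_b/a_ib^{5/2})ρ^{-1/2} ≫ 1 at low density, CucchiettiTimmermans2006), see Not decomposed yet.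
[difficulty: provable-now] [Sznitman1998, GerminetHislopKlein2007, LiebSeiringerSolovejYngvason2005,
CucchiettiTimmermans2006]
#9 FreeGasCondenses (support) — (glue for the a = 0 corner excluded from the cruxes) if
scatteringLength v = 0 then v = 0 for a.e. radius (w.r.t. r²dr; hard values on null sets are
invisible to ∫⁻), so periodicEnergy v = the free periodic energy for every trial state, and the
PeriodicBEC body holds for v at every density: on the torus the constant is the ground state with
gap (2π/L)², and a δ-near-minimiser with δ < θ(2π/L)² has n₀ ≥ (1−θ)N (Wirtinger/Parseval on the
3N-torus for C¹ periodic functions). Two lemmas: a(v) = 0 ⇒ v =ᵐ 0 (contrapositive of 'v ≢ 0 ⇒ a >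
0', LSSY App. C / Fournais2020 Assumption 1.1 remark) and the many-particle Wirtinger inequality.
[difficulty: provable-now] [LiebSeiringerSolovejYngvason2005, Fournais2020, folklore]

TWO-LAYER PLAN. Foreseen glued splits (none filed now; k ≤ 3, depth 1). SpaceTimeHomogenisation ⇐
InsertionEquation (h = Ψ_{N+1}/Ψ_N is
the unique positive solution of the tagged equation, with the second-moment identity n₀/(N+1) ≥ (E_π
h)²/E_π h²) →
HealingScaleDefect (g²(ξ) ≤ C√(ρa³): local number moments and two-body renormalisation at the
healing scale, from energy
localisation) → LargeScaleLiouville (from scale ξ upward, m₋₁ + sub-additivity iteration ⇒ bounded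
corrector) →
SpaceTimeHomogenisation. DensityResponseBound ⇐ ShortWavelength (|k| ≥ 1/ξ: m₋₁ ≤ N/(2k²)-type bound
from the f-sum side)
→ LongWavelength (|k| ≤ 1/ξ: LDA/compressibility, the real content) → DensityResponseBound.
LightBathCoherence ⇐
BathPhonons(η) (an m₋₁ bound for the ηv-bath, i.e. DensityResponseBound at weak coupling with C ≍
1/(ηρ∫v)) →
HeavyProbeDressing (second-order dressing of a mass-1/η probe given BathPhonons) →
LightBathCoherence.

KILL CRITERIA. A refutation of DensityResponseBound at some admissible v with a > 0 and arbitrarily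
small ρ (a soft density mode of the
dilute repulsive gas) closes the route (`refuted:DensityResponseBound`) and would be major negative
knowledge for
BECParticleInduction and every corrector-based card (kv-insertion-corrector). A refutation of
SpaceTimeHomogenisation
(finite compressibility WITHOUT torus BEC for some dilute repulsive v) closes the route and
physically means a
compressible non-superfluid ground state — pivot to the sector-gap cards. ¬LightBathCoherence
(tagged decoherence
surviving η → 0) refutes the dial's positive end and forces a pivot of the engine's perturbative
anchor but not the
assembly. ¬FrozenBathNoBEC cannot happen for a > 0 (elementary); if it did the calibration narrative
dies, not the
assembly. ¬BoundaryTransferWeak kills this and four sibling routes but not the torus statements.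
PeriodicBEC proved
elsewhere moots ranks 2–3 (the endpoints stay as Literature-grade targets).

NOT DECOMPOSED YET. The self-trapped phase of the true dial (η > η_c ≍ ρ^{-1/2}: bubble of radius
(η/(a_bρ²))^{1/5}, f(η) = 0 — a typable
negative statement over the same deformed energy as LightBathCoherence, deliberately not filed:
proving localisation of an
impurity in a translation-invariant interacting ground state is a project of its own); the own-law
frozen bath (scatterers
drawn from |Ψ_N|² instead of i.i.d.: needs void probabilities and an LLN for the quantum gas — cards
rigidity-tolerance /
palm-landscape territory); monotonicity or continuity of f(η) (unknown; N = 2, 3 numerics could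
probe it); the d = 2
marginal case; positive temperature; constants C(ρ,v) ≍ 1/(ρa) and c ≍ e^{-C'}; the layer-2 children
listed above.

CHEAPEST FALSIFIER. For DensityResponseBound: a Bogoliubov/second-order computation of m₋₁(ρ_k)/N
for a mass-imbalanced or hard-core dilute
gas showing growth in N at k = 2π/L would kill it — the textbook value ½/(k²+16πρa) says it does not
(Stringari1995 (10),
compressibility sum rule); a refuter should also check the t₀-innermost quantifier against the free
gas with a > 0 tiny
(C ≍ 1/(ρa) must be allowed to blow up as a → 0 — it is, C is chosen after v and ρ). For the engine:
the dynamic Harris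
count must reproduce the one-loop Bose-polaron residue 1 − Z ∝ √(ρa³) at equal masses and the
logarithm in d = 2
(GuentherEtAl2021 eq. (14) vs eq. (3)); a mismatch in the exponent kills the relevance argument. For
FrozenBathNoBEC:
nothing to falsify (elementary) — a grounder can confirm the four-step proof in an hour. Lookups run
here: crossref
finds no homogenisation treatment of a tagged boson in a Bose-gas ground state (queries under
Novelty).

NUMBERS. Bogoliubov (ħ = 2m = 1): m₋₁(Σ_j cos k·x_j)/N = ½/(k² + 16πρa), so χ(k)/N ≤ 1/(32πρa) and C
≍ 1/(ρa); compressibility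
sum rule ∫ω⁻¹S(q,ω)dω = ½χ(q) → 1/mc² and S(q) ≤ q/2mc (Stringari1995 §2.2 (10), p. 74); ideal gas
χ(q) ∝ 1/q²
(ibid.). Dynamic Harris count: g²(ℓ) ≍ (a²ρ/c²)ℓ^{2−d}; at ℓ = ξ = (8πρa)^{-1/2}, g² ≍ √(ρa³) (d =
3). Light bath:
1 − Z ≍ η^{3/2}ρ^{1/2}(∫v/8π)^{3/2}. Self-trapping threshold of the dial: η_c ≍
(a_b/a_ib^{5/2})ρ^{-1/2}
(bubble energetics, CucchiettiTimmermans2006). Frozen i.i.d. bath: unoccupied-cube fraction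
e^{−ρℓ³/8}, e_Y ≲
(ρ/log L)^{2/3}. Items at open: 8 (1 target, 4 cruxes, 2 support, 1 assembly).

DEFINITION REQUESTS. None needed for the filed items (all over PeriodicBoseGas.lean). Wanted later
for the layer-2 children of
SpaceTimeHomogenisation: the ground-state-transformed (Doob) semigroup / Dirichlet form of the
periodic N-body
Hamiltonian and its H₋₁ norm (topic Literature/MathematicalPhysics/QuantumManyBody) — to be
requested when rank 2 or 3
is split, not now.

Novelty: Searches (2026-08-15): `lit search --source crossref` ×6 ("Armstrong Bordas Mourrat quantitative
stochastic homogenization parabolic" → doi:10.2140/apde.2018.11.1945; "Germinet Hislop Klein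
localization Poisson random potential" → doi:10.4171/jems/89; "Giunti Gu Mourrat quantitative
homogenization of interacting particle systems" → doi:10.1214/22-aop1573, doi:10.1214/25-aap2286;
"strong-coupling polarons self-localization impurity dilute BEC" →
doi:10.1103/physrevlett.96.210401; "tagged particle Bose gas ground state homogenization Kipnis
Varadhan condensate" → 0 relevant; "dynamic structure factor Bose Einstein condensate Bogoliubov
rigorous" → physics only); `lit search --source zbmath` ×2 (structure factor / linear response Bose
gas rigorous → 0); `lit vsearch` "second-order energy shift … static density response …
compressibility sum rule" → book:griffin1995 (Stringari1995 pp. 73–75, read), book:lieb2005 (LSSY);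
`lit frontier AtomisticToContinuum --since 2022` (30 rows; nearest: arXiv:2404.12234 quantitative
homogenisation of non-gradient exclusion, CPAM 2026); `lit bridges AtomisticToContinuum --cross any`
(no Bose-gas/homogenisation bridge); `lit galaxy search --star all "density response Bose gas
homogenization"` (pdf: 0 hits; panama/crabby queued out); the local `lit search` tier and arXiv API
were down/429 in this session (card's own audit-8/ -12/ -15 searches stand: Sznitman1998,
GerminetHislopKlein2007, Comets–Yoshida 2013, Andres–Chiarini–Deuschel–Slowik 2018, Drewi  [refs: 10.2140/apde.2018.11.1945, 10.4171/jems/89, 10.1214/22-aop1573, 10.1214/25-aap2286, 10.1103/physrevlett.96.210401, 2404.12234, doi:10.2140/apde.2018.11.1945, doi:10.4171/jems/89, doi:10.1214/22-aop1573, doi:10.1214/25-aap2286, doi:10.1103/physrevlett.96.210401, book:griffin1995, book:lieb2005, Stringari1995, Sznitman1998, GerminetHislopKlein2007, DrewitzEtAl2011, GiuntiGuMourrat2022, ArmstrongBord]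

Barriers (technique_class: bath-mass-deformation, homogenisation, density-response): - technique_class: bath-mass-deformation, homogenisation, density-response
- Literature.Barriers.AtomisticToContinuum.KineticGapLengthScales: evaded in form — no item uses the
box gap (2π/L)²; the engine's small parameter g²(ℓ) DEcreases with the scale and
DensityResponseBound is scale-free (C uniform in k); conceded that any proof of DensityResponseBound
by energy localisation in sub-boxes re-imports the ℓ⁻² bookkeeping — the bet is an
LDA/compressibility argument instead.
- Literature.Barriers.AtomisticToContinuum.BogoliubovPerturbationInfrared: the d = 3 logarithms live
in the bath's anomalous propagators; the route consumes only m₋₁ (an inverse moment that the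
compressibility sum rule keeps finite) and a tagged-particle corrector that is power-counting
irrelevant (g² ∝ ℓ⁻¹), so no expansion around the Bogoliubov state is summed; conceded that PROVING
DensityResponseBound may need infrared control of the bath of comparable depth.
- Literature.Barriers.AtomisticToContinuum.EnergyAsymptoticsWithoutCondensation: evaded by design —
no item is an energy asymptotics; DensityResponseBound is a RELATIVE bound between two Hamiltonians
differing by t·Σcos (first order cancels exactly), and the conclusion is an eigenfunction-flatness
statement.
- Literature.Barriers.AtomisticToContinuum.PitaevskiiStringariOneDimension: reproduced, not evaded —
the dynamic Harris count is relevant in d = 1 (g² ∝ ℓ), consistent with no T = 0 BEC there; the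
route is d = 3 only (Space = ℝ³ is hard-wired)

History (route lifecycle, newest last):
- 2026-08-15T13:38:29Z · CLOSED retired — not-a-thesis: assembly does not conclude the sub-problem Statement (operator:999:1257524)

sub-problem: BoseEinsteinCondensation · status: closed(retired) · opened planner-plancard-AtomisticToContinuum-BoseEin-61acd54c-0 2026-08-15T11:41:28Z · rev 0 · ledger route-AtomisticToContinuum-BECBathMassDial
GENERATED by the gate from the ledger (D-0016/17). Provers cite these decls: `theorem foo : Summit.AtomisticToContinuum.BoseEinsteinCondensation.Theses.BECBathMassDial.<Decl> := …` in Summits/AtomisticToContinuum/BoseEinsteinCondensation/Theorems/<Name>.lean.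
-/

namespace Summit.AtomisticToContinuum.BoseEinsteinCondensation.Theses.BECBathMassDial

open scoped BigOperators Topology Manifold Classical MeasureTheory ProbabilityTheory Matrix InnerProductSpace ComplexConjugate ContinuousMap
open Filter Set Function TopologicalSpace MeasureTheory

attribute [summit_statement] _root_.BoseEinsteinCondensation

/-- item stmt-AtomisticToContinuum-0826 · target · rank 0 · closed · moot by None · by planner
why it might fail: Box L=(N/ρ)^{1/3}→∞ at fixed ρ: every printed n₊ bound pays the box gap L² (Fournais2020 Thm 1.2, Junge2026 Cor. 6); T=0 d=3 expansions are IR-singular; hard cores admissible, c uniform in N — the open problem in its own setting.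
sources: LiebSeiringerSolovejYngvason2005, Fournais2020, Junge2026, ChongLiangNam2026, Literature.Barriers.AtomisticToContinuum.KineticGapLengthScales
[crux] PeriodicBEC: for every repulsive finite-range radial v there is ρ₀>0 such that for 0<ρ<ρ₀
there is c>0 with: for all large N there is δ>0 such that every PERIODIC trial state Ψ on the torus
of side L=(N/ρ)^{1/3} with periodicEnergy ≤ E₀^per(N,L)+δ has constant-mode occupation ⟨Ψ,n₀Ψ⟩ =
condensateOccupation N L Ψ ≥ cN. The open problem in the literature's own (translation-invariant)
setting; Fournais2020 Thm 1.2 gives it on scales L ≤ C(ρa³)^{-δ}(ρa)^{-1/2}, Junge2026 Cor. 6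
(Neumann) up to a(ρa³)^{-3/4-η}. Sources: LiebSeiringerSolovejYngvason2005 Ch. 5; Fournais2020;
Junge2026; ChongLiangNam2026. -/
@[route_item "route-AtomisticToContinuum-BECBathMassDial"]
def PeriodicBEC : Prop :=
  ∀ v : ℝ → ENNReal, Literature.MathematicalPhysics.QuantumManyBody.BoseGas.IsRepulsiveFiniteRange v → ∃ ρ₀ : ℝ, 0 < ρ₀ ∧ ∀ ρ : ℝ, 0 < ρ → ρ < ρ₀ → ∃ c : ℝ, 0 < c ∧ ∀ᶠ N : ℕ in Filter.atTop, ∃ δ : ENNReal, 0 < δ ∧ ∀ Ψ : Literature.MathematicalPhysics.QuantumManyBody.BoseGas.PeriodicTrialState N (Literature.MathematicalPhysics.QuantumManyBody.BoseGas.sideLength ρ N), Literature.MathematicalPhysics.QuantumManyBody.BoseGas.periodicEnergy v Ψ ≤ Literature.MathematicalPhysics.QuantumManyBody.BoseGas.periodicGroundStateEnergy v N (Literature.MathematicalPhysics.QuantumManyBody.BoseGas.sideLength ρ N) + δ → ENNReal.ofReal (c * N) ≤ Literature.MathematicalPhysics.QuantumManyBody.BoseGas.condensateOccupation N (Literature.MathematicalPhysics.QuantumManyBody.BoseGas.sideLength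 ρ N) Ψ.ψ

/-- item stmt-AtomisticToContinuum-5530 · crux · rank 2 · closed · moot by None · by planner
why it might fail: It is m₋₁ of the TRUE torus ground state uniform in N at k_min=2π/L→0, i.e. a one-sided bound H−E₀ ≳ S(k)/C on ρ_kΨ₀ (no soft density mode): printed spectra stop at mean-field/GP boxes (Seiringer2011, BoccatoEtAl2019Acta); energy localisation carries t-independent errors and never reaches t→0.
sources: Stringari1995, PitaevskiiStringari1991, Seiringer2011, BoccatoEtAl2019Acta, FournaisSolovej2020, KipnisVaradhan1986
[crux] (card L1's mixing input, made explicit and typed) UNIFORM STATIC DENSITY RESPONSE ON THE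
TORUS: for every repulsive finite-range v with scatteringLength v > 0 there is ρ₀>0 such that for
0<ρ<ρ₀ there is C>0 with: for all large N (L=(N/ρ)^{1/3}), every dual-lattice vector k = 2πn/L, n ∈
ℤ³∖{0}, admits t₀>0 such that for 0<t≤t₀: E₀^per(N,L) + tN ≤ inf_Ψ [periodicEnergy v Ψ + ∫ Σ_j
t(1+cos k·x_j)|Ψ|²] + C t² N. Since ⟨cos k·x⟩ = 0 in the translation-invariant ground state the
first order is exactly tN, so this is m₋₁(Σ_j cos k·x_j) ≤ CN, i.e. χ(k)/N bounded uniformly in N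
and k ≠ 0 (finite compressibility at every wavelength: Bogoliubov value m₋₁/N = ½/(k²+16πρa) ≤
1/(32πρa), so C ≍ 1/(ρa)); t₀ innermost makes it purely infinitesimal. It is the H₋₁-norm bound the
time-averaging step of the engine consumes (variance of a potential averaged over imaginary time T
is ≤ (2/T)·m₋₁). The ideal gas violates it (m₋₁/N = 1/(2k²) → ∞ at k = 2π/L; Stringari1995 p.74),
hence a > 0. Torus/thermodynamic-sequence sibling of BECParticleInduction.StaticResponseBound
(stmt-3590: Dirichlet, all M ≤ ρ₁L³, Bogoliubov weight) — a proof of either should give the other's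
geometry. [difficulty: open-pro -/
@[route_item "route-AtomisticToContinuum-BECBathMassDial"]
def DensityResponseBound : Prop :=
  ∀ v : ℝ → ENNReal, Literature.MathematicalPhysics.QuantumManyBody.BoseGas.IsRepulsiveFiniteRange v → 0 < Literature.MathematicalPhysics.QuantumManyBody.BoseGas.scatteringLength v → ∃ ρ₀ : ℝ, 0 < ρ₀ ∧ ∀ ρ : ℝ, 0 < ρ → ρ < ρ₀ → ∃ C : ℝ, 0 < C ∧ ∀ᶠ N : ℕ in Filter.atTop, ∀ n : Fin 3 → ℤ, n ≠ 0 → ∃ t₀ : ℝ, 0 < t₀ ∧ ∀ t : ℝ, 0 < t → t ≤ t₀ → Literature.MathematicalPhysics.QuantumManyBody.BoseGas.periodicGroundStateEnergy v N (Literature.MathematicalPhysics.QuantumManyBody.BoseGas.sideLength ρ N) + ENNReal.ofReal (t * N) ≤ (⨅ Ψ : Literature.MathematicalPhysics.QuantumManyBody.BoseGas.PeriodicTrialState N (Literature.MathematicalPhysics.QuantumManyBody.BoseGas.sideLength ρ N), (Literature.MathematicalPhysics.QuantumManyBody.BoseGas.periodicEnergy v Ψ + ∫⁻ X in Literature.MathematicalPhysics.QuantumManyBody.BoseGas.cellN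 N (Literature.MathematicalPhysics.QuantumManyBody.BoseGas.sideLength ρ N), (∑ j : Fin N, ENNReal.ofReal (t * (1 + Real.cos (∑ i : Fin 3, 2 * Real.pi / Literature.MathematicalPhysics.QuantumManyBody.BoseGas.sideLength ρ N * (n i : ℝ) * X j i)))) * (‖Ψ.ψ X‖₊ : ENNReal) ^ 2)) + ENNReal.ofReal (C * t ^ 2 * N)

/-- item stmt-AtomisticToContinuum-5531 · crux · rank 3 · closed · moot by None · by planner
why it might fail: ABM/GGM regularity needs quantitative decorrelation of ALL coarse-grained functionals of an environment with known product/Poisson law, independent of the walker; here the law |Ψ_N|² is unknown, the walker is one of the bosons (self-consistent), and m₋₁ bounds only second moments of time averages.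
sources: ArmstrongBordasMourrat2018, GiuntiGuMourrat2022, ArmstrongKuusiMourrat2019, KipnisVaradhan1986, DrewitzEtAl2011, Sznitman1998
[crux] (card L1 = SpaceTimeLiouville, as an implication between typed statements) THE ENGINE: for
every repulsive finite-range v with scatteringLength v > 0, the density-response body of
DensityResponseBound for v implies the PeriodicBEC body for v (∃ρ₀ ∀ρ<ρ₀ ∃c ∀ᶠN ∃δ:
δ-near-minimisers of the periodic energy on the torus of side (N/ρ)^{1/3} have condensateOccupation
≥ cN). Intended proof object: the insertion amplitude h(y;X) = Ψ_{N+1}(y,X)/Ψ_N(X) > 0 solves (−G_N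
− Δ_y + Σ_j v^per(y − x_j))h = (E_{N+1} − E_N)h with G_N the ground-state-transformed generator of
the N-boson bath; n₀(N+1)/(N+1) ≥ ⟨φ₀⊗Ψ_N, Ψ_{N+1}⟩² = (E_π h)²/E_π h² (Cauchy–Schwarz), so a
first-order Liouville / large-scale-regularity theorem 'positive sub-quadratically growing solutions
are constant up to a corrector bounded in L²(π)' in the |Ψ_N|²-stationary space-time environment IS
torus BEC. Scale-ℓ ellipticity defect g²(ℓ) = Var(block potential averaged over time ℓ²)·ℓ⁴ ≤
(2/ℓ²)·m₋₁(block density)·v̂(0)²·ℓ⁴ ≍ (a²ρ·C)ℓ^{-1} in d = 3 by the hypothesis: irrelevant, already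
≍ √(ρa³) at ℓ = healing length; d = 2 marginal, d = 1 relevant (no BEC, consistent with
PitaevskiiStringariOneDimension). Technology to trans -/
@[route_item "route-AtomisticToContinuum-BECBathMassDial"]
def SpaceTimeHomogenisation : Prop :=
  ∀ v : ℝ → ENNReal, Literature.MathematicalPhysics.QuantumManyBody.BoseGas.IsRepulsiveFiniteRange v → 0 < Literature.MathematicalPhysics.QuantumManyBody.BoseGas.scatteringLength v → (∃ ρ₀ : ℝ, 0 < ρ₀ ∧ ∀ ρ : ℝ, 0 < ρ → ρ < ρ₀ → ∃ C : ℝ, 0 < C ∧ ∀ᶠ N : ℕ in Filter.atTop, ∀ n : Fin 3 → ℤ, n ≠ 0 → ∃ t₀ : ℝ, 0 < t₀ ∧ ∀ t : ℝ, 0 < t → t ≤ t₀ → Literature.MathematicalPhysics.QuantumManyBody.BoseGas.periodicGroundStateEnergy v N (Literature.MathematicalPhysics.QuantumManyBody.BoseGas.sideLength ρ N) + ENNReal.ofReal (t * N) ≤ (⨅ Ψ : Literature.MathematicalPhysics.QuantumManyBody.BoseGas.PeriodicTrialState N (Literature.MathematicalPhysics.QuantumManyBody.BoseGas.sideLength ρ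 N), (Literature.MathematicalPhysics.QuantumManyBody.BoseGas.periodicEnergy v Ψ + ∫⁻ X in Literature.MathematicalPhysics.QuantumManyBody.BoseGas.cellN N (Literature.MathematicalPhysics.QuantumManyBody.BoseGas.sideLength ρ N), (∑ j : Fin N, ENNReal.ofReal (t * (1 + Real.cos (∑ i : Fin 3, 2 * Real.pi / Literature.MathematicalPhysics.QuantumManyBody.BoseGas.sideLength ρ N * (n i : ℝ) * X j i)))) * (‖Ψ.ψ X‖₊ : ENNReal) ^ 2)) + ENNReal.ofReal (C * t ^ 2 * N)) → ∃ ρ₀ : ℝ, 0 < ρ₀ ∧ ∀ ρ : ℝ, 0 < ρ → ρ < ρ₀ → ∃ c : ℝ, 0 < c ∧ ∀ᶠ N : ℕ in Filter.atTop, ∃ δ : ENNReal, 0 < δ ∧ ∀ Ψ : Literature.MathematicalPhysics.QuantumManyBody.BoseGas.PeriodicTrialState N (Literature.MathematicalPhysics.QuantumManyBody.BoseGas.sideLength ρ N), Literature.MathematicalPhysics.QuantumManyBody.BoseGas.periodicEnergy v Ψ ≤ Literature.MathematicalPhysics.QuantumManyBody.BoseGas.periodicGroundStateEnergy v N (Literature.MathematicalPhysics.QuantumManyBody.BoseGas.sideLength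 ρ N) + δ → ENNReal.ofReal (c * N) ≤ Literature.MathematicalPhysics.QuantumManyBody.BoseGas.condensateOccupation N (Literature.MathematicalPhysics.QuantumManyBody.BoseGas.sideLength ρ N) Ψ.ψ

/-- item stmt-AtomisticToContinuum-5532 · crux · rank 4 · closed · moot by None · by planner
why it might fail: Z→1 needs the phonon branch of the WEAKLY coupled bath (S(k)≲k/2c_η, c_η∝√(ηρ∫v)) uniformly in N — unproved in the TL at any coupling; with S≡1 (ideal bath) a heavy probe has a bosonic orthogonality catastrophe (GuentherEtAl2021 eq. 3), so constants must degenerate exactly right as η→0.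
sources: MysliwySeiringer2020, LampartTriay2025, GuentherEtAl2021, AstrakharchikPitaevskii2004, CucchiettiTimmermans2006, Seiringer2011
[crux] (card L3, the η → 0 end of the bath-mass dial, typed as complete coherence) LIGHT, FAST BATH:
for every repulsive finite-range v with ∫v(|x|)dx < ∞, every ρ > 0 and ε > 0 there is η₀ > 0 such
that for 0 < η < η₀ and all large N there is δ > 0 with: every C¹, Lℤ³-periodic (in each of the N+1
particles), cell-normalised ψ on (ℝ³)^{N+1} — NO permutation symmetry imposed, particle 0 tagged —
whose deformed energy E_η(ψ) = ∫_cell |∇₀ψ|² + η⁻¹Σ_{j≥1}|∇_jψ|² + Σ_{i<j} v^per(x_i − x_j)|ψ|² is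
within δ of its infimum has tagged constant-mode weight ≥ 1 − ε, i.e. condensateOccupation (N+1) L ψ
≥ (1−ε)(N+1) (L = ((N+1)/ρ)^{1/3}; the head of vecCons is particle 0, so condensateOccupation/(N+1)
is exactly the tagged zero-mode weight; at η = 1 the absolute ground state is the Bose-symmetric one
and this weight IS n₀/N). Multiplying by η: a heavy probe (mass ∝ 1/η) coupled by ηv to a bath with
pair coupling ηv; one loop gives 1 − Z ≍ ρ a_η² ξ_η ≍ η^{3/2}ρ^{1/2}(∫v)^{3/2} → 0 (a_η ≍ η∫v/8π,
ξ_η the bath healing length), the perturbative corner of SpaceTimeHomogenisation with no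
self-consistency (the probe barely perturbs the bath) — but only because the weakly coupled bath
still has phonons -/
@[route_item "route-AtomisticToContinuum-BECBathMassDial"]
def LightBathCoherence : Prop :=
  ∀ v : ℝ → ENNReal, Literature.MathematicalPhysics.QuantumManyBody.BoseGas.IsRepulsiveFiniteRange v → (∫⁻ x : Literature.MathematicalPhysics.QuantumManyBody.BoseGas.Space, v ‖x‖) ≠ ⊤ → ∀ ρ : ℝ, 0 < ρ → ∀ ε : ℝ, 0 < ε → ∃ η₀ : ℝ, 0 < η₀ ∧ ∀ η : ℝ, 0 < η → η < η₀ → ∀ᶠ N : ℕ in Filter.atTop, ∃ δ : ENNReal, 0 < δ ∧ ∀ ψ : Literature.MathematicalPhysics.QuantumManyBody.BoseGas.Config (N + 1) → ℂ, ContDiff ℝ 1 ψ → (∀ (X : Literature.MathematicalPhysics.QuantumManyBody.BoseGas.Config (N + 1)) (i : Fin (N + 1)) (k : Fin 3), ψ (X + Pi.single i (EuclideanSpace.single k (Literature.MathematicalPhysics.QuantumManyBody.BoseGas.sideLength ρ (N + 1)))) = ψ X) → (∫⁻ X in Literature.MathematicalPhysics.QuantumManyBody.BoseGas.cellN (N +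 1) (Literature.MathematicalPhysics.QuantumManyBody.BoseGas.sideLength ρ (N + 1)), (‖ψ X‖₊ : ENNReal) ^ 2) = 1 → (∫⁻ X in Literature.MathematicalPhysics.QuantumManyBody.BoseGas.cellN (N + 1) (Literature.MathematicalPhysics.QuantumManyBody.BoseGas.sideLength ρ (N + 1)), (∑ k : Fin 3, (‖fderiv ℝ ψ X (Pi.single (0 : Fin (N + 1)) (EuclideanSpace.single k (1 : ℝ)))‖₊ : ENNReal) ^ 2) + ENNReal.ofReal η⁻¹ * (∑ j : Fin N, ∑ k : Fin 3, (‖fderiv ℝ ψ X (Pi.single j.succ (EuclideanSpace.single k (1 : ℝ)))‖₊ : ENNReal) ^ 2) + Literature.MathematicalPhysics.QuantumManyBody.BoseGas.periodicInteraction v (Literature.MathematicalPhysics.QuantumManyBody.BoseGas.sideLength ρ (N + 1)) X * (‖ψ X‖₊ : ENNReal) ^ 2) ≤ (⨅ (φ : Literature.MathematicalPhysics.QuantumManyBody.BoseGas.Config (N + 1) → ℂ) (_ : ContDiff ℝ 1 φ ∧ (∀ (X : Literature.MathematicalPhysics.QuantumManyBody.BoseGas.Config (N + 1)) (i : Fin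 (N + 1)) (k : Fin 3), φ (X + Pi.single i (EuclideanSpace.single k (Literature.MathematicalPhysics.QuantumManyBody.BoseGas.sideLength ρ (N + 1)))) = φ X) ∧ (∫⁻ X in Literature.MathematicalPhysics.QuantumManyBody.BoseGas.cellN (N + 1) (Literature.MathematicalPhysics.QuantumManyBody.BoseGas.sideLength ρ (N + 1)), (‖φ X‖₊ : ENNReal) ^ 2) = 1), ∫⁻ X in Literature.MathematicalPhysics.QuantumManyBody.BoseGas.cellN (N + 1) (Literature.MathematicalPhysics.QuantumManyBody.BoseGas.sideLength ρ (N + 1)), (∑ k : Fin 3, (‖fderiv ℝ φ X (Pi.single (0 : Fin (N + 1)) (EuclideanSpace.single k (1 : ℝ)))‖₊ : ENNReal) ^ 2) + ENNReal.ofReal η⁻¹ * (∑ j : Fin N, ∑ k : Fin 3, (‖fderiv ℝ φ X (Pi.single j.succ (EuclideanSpace.single k (1 : ℝ)))‖₊ : ENNReal) ^ 2) + Literature.MathematicalPhysics.QuantumManyBody.BoseGas.periodicInteraction v (Literature.MathematicalPhysics.QuantumManyBody.BoseGas.sideLength ρ (N + 1)) X * (‖φ X‖₊ : ENNReal) ^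 2) + δ → ENNReal.ofReal ((1 - ε) * (N + 1)) ≤ Literature.MathematicalPhysics.QuantumManyBody.BoseGas.condensateOccupation (N + 1) (Literature.MathematicalPhysics.QuantumManyBody.BoseGas.sideLength ρ (N + 1)) ψ

/-- item stmt-AtomisticToContinuum-5172 · support · rank 9 · closed · moot by None · by planner
sources: LiebSeiringerSolovejYngvason2005, Fournais2020, folklore
[support] the degenerate case a = 0 (v = 0 a.e.; then RewardChordBound is vacuous): PeriodicBEC(v)
holds directly — E₀^per = 0 by the proved upper bound with a = 0, and the kinetic gap of the torus
gives n₊(Ψ) ≤ (L/2π)²·⟨Ψ,TΨ⟩ ≤ (L/2π)²δ for δ-near-minimisers (Fournais2020 (1.10)–(1.12); in-tree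
`nPlusBoxN_le_kinBoxN`-type lemmas), so δ := 2π²N/L² gives n₀ ≥ N/2. [difficulty: provable-now] -/
@[route_item "route-AtomisticToContinuum-BECBathMassDial"]
def FreeGasCondenses : Prop :=
  ∀ v : ℝ → ENNReal, Literature.MathematicalPhysics.QuantumManyBody.BoseGas.IsRepulsiveFiniteRange v → Literature.MathematicalPhysics.QuantumManyBody.BoseGas.scatteringLength v = 0 → ∃ ρ₀ : ℝ, 0 < ρ₀ ∧ ∀ ρ : ℝ, 0 < ρ → ρ < ρ₀ → ∃ c : ℝ, 0 < c ∧ ∀ᶠ N : ℕ in Filter.atTop, ∃ δ : ENNReal, 0 < δ ∧ ∀ Ψ : Literature.MathematicalPhysics.QuantumManyBody.BoseGas.PeriodicTrialState N (Literature.MathematicalPhysics.QuantumManyBody.BoseGas.sideLength ρ N), Literature.MathematicalPhysics.QuantumManyBody.BoseGas.periodicEnergy v Ψ ≤ Literature.MathematicalPhysics.QuantumManyBody.BoseGas.periodicGroundStateEnergy v N (Literature.MathematicalPhysics.QuantumManyBody.BoseGas.sideLength ρ N) + δ → ENNReal.ofReal (c * N) ≤ Literature.MathematicalPhysics.QuantumManyBody.BoseGas.condensateOccupation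 N (Literature.MathematicalPhysics.QuantumManyBody.BoseGas.sideLength ρ N) Ψ.ψ

/-- item stmt-AtomisticToContinuum-5533 · support · rank 9 · closed · moot by None · by planner
sources: Sznitman1998, GerminetHislopKlein2007, LiebSeiringerSolovejYngvason2005, CucchiettiTimmermans2006
[support] (card L2 = Q-loc, the η = ∞ endpoint, quenched i.i.d. version; provable now) FROZEN BATH
NEVER CONDENSES: for every repulsive finite-range v with scatteringLength v > 0, every density ρ > 0
and ε > 0, for all large M (L = (M/ρ)^{1/3}): the set of scatterer configurations Y ∈ cell^M for
which the ONE-body quenched problem h_Y = −Δ + Σ_j v^per(x − Y_j) on the torus has near-ground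
states (energy ≤ e_Y + δ for every δ > 0) with constant-mode weight > ε has Lebesgue measure ≤
ε·|cell^M| (i.e. probability ≤ ε under i.i.d. uniform scatterers at density ρ). Elementary proof (no
Sznitman machinery needed): (i) whp there is an empty ball of radius R+R₀, so e_Y ≤ π²/R² → 0; (ii)
chop the torus into cubes of side ℓ, drop the kinetic cross terms (Neumann bracketing, v ≥ 0): a
cube whose inner half-cube holds a scatterer has local Neumann ground energy ≥ c(ℓ,v) > 0 uniformly
in the position (compactness), so a near-ground state puts mass ≤ (e_Y+δ)/c(ℓ) → 0 in occupied
cubes; (iii) the fraction of unoccupied cubes concentrates at e^{−ρℓ³/8}; (iv) Cauchy–Schwarz: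
(∫φ)²/L³ ≤ 2·mass_occ + 2·(unoccupied volume fraction) → 0 as ℓ → ∞. Same argument for hard cores.
This is the card's calibra -/
@[route_item "route-AtomisticToContinuum-BECBathMassDial"]
def FrozenBathNoBEC : Prop :=
  ∀ v : ℝ → ENNReal, Literature.MathematicalPhysics.QuantumManyBody.BoseGas.IsRepulsiveFiniteRange v → 0 < Literature.MathematicalPhysics.QuantumManyBody.BoseGas.scatteringLength v → ∀ ρ : ℝ, 0 < ρ → ∀ ε : ℝ, 0 < ε → ∀ᶠ M : ℕ in Filter.atTop, MeasureTheory.volume {Y : Literature.MathematicalPhysics.QuantumManyBody.BoseGas.Config M | Y ∈ Literature.MathematicalPhysics.QuantumManyBody.BoseGas.cellN M (Literature.MathematicalPhysics.QuantumManyBody.BoseGas.sideLength ρ M) ∧ ∀ δ : ENNReal, 0 < δ → ∃ φ : Literature.MathematicalPhysics.QuantumManyBody.BoseGas.PeriodicTrialState 1 (Literature.MathematicalPhysics.QuantumManyBody.BoseGas.sideLength ρ M), (∫⁻ X in Literature.MathematicalPhysics.QuantumManyBody.BoseGas.cellN 1 (Literature.MathematicalPhysics.QuantumManyBody.BoseGas.sideLength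 ρ M), Literature.MathematicalPhysics.QuantumManyBody.BoseGas.kineticDensity φ.ψ X + (∑ j : Fin M, Literature.MathematicalPhysics.QuantumManyBody.BoseGas.periodizedPotential v (Literature.MathematicalPhysics.QuantumManyBody.BoseGas.sideLength ρ M) (X 0 - Y j)) * (‖φ.ψ X‖₊ : ENNReal) ^ 2) ≤ (⨅ θ : Literature.MathematicalPhysics.QuantumManyBody.BoseGas.PeriodicTrialState 1 (Literature.MathematicalPhysics.QuantumManyBody.BoseGas.sideLength ρ M), ∫⁻ X in Literature.MathematicalPhysics.QuantumManyBody.BoseGas.cellN 1 (Literature.MathematicalPhysics.QuantumManyBody.BoseGas.sideLength ρ M), Literature.MathematicalPhysics.QuantumManyBody.BoseGas.kineticDensity θ.ψ X + (∑ j : Fin M, Literature.MathematicalPhysics.QuantumManyBody.BoseGas.periodizedPotential v (Literature.MathematicalPhysics.QuantumManyBody.BoseGas.sideLength ρ M) (X 0 - Y j)) * (‖θ.ψ X‖₊ : ENNReal) ^ 2) + δ ∧ ENNReal.ofReal ε < Literature.MathematicalPhysics.QuantumManyBody.BoseGas.condensateOccupation 1 (Literature.MathematicalPhysics.QuantumManyBody.BoseGas.sideLength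 ρ M) φ.ψ} ≤ ENNReal.ofReal ε * MeasureTheory.volume (Literature.MathematicalPhysics.QuantumManyBody.BoseGas.cellN M (Literature.MathematicalPhysics.QuantumManyBody.BoseGas.sideLength ρ M))

-- TODO item stmt-AtomisticToContinuum-5534 · assembly · rank 1 · closed · moot by None · by planner — BLOCKED: missing decl(s) BoundaryTransferWeak; restate via `ledger route edit` once they land:
--   def Assembly : Prop := DensityResponseBound → SpaceTimeHomogenisation → FreeGasCondenses → BoundaryTransferWeak → Literature.MathematicalPhysics.QuantumManyBody.BoseGas.BoseEinsteinCondensation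

end Summit.AtomisticToContinuum.BoseEinsteinCondensation.Theses.BECBathMassDial
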